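import Mathlib
import Literature.Dynamics.ConleyIndex.PolyfacialBlock
import HarnessLib

/-!
# Second-order internal tangencies: the stay lemma
# (crux stmt-AnomalousDissipation-10352 `WazewskiBlock.UniformGalerkinTrap`, line `Sketch`, lead c2 — negative tool)

Lead c1's registered recipe `Sketch.not_isClosed_immediateExitSet_of_tangency` (p108924) refutes closedness of the immediate
exit set `B⁻` of a polyfacial block `faceSet h ∩ M` from two inputs: a point `x` that STAYS in the block for all small positive
times, and a sequence of first-order exit points converging to `x`.  This file supplies the first input from POINTWISE data of
order ≤ 2 at `x` — the form in which the lead's refutation of the line's bet is certified (dossier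
`Cruxes/UniformGalerkinTrap/Lines/SketchDead.md`, Theorem 1 case (d): on the energy face `KE = E` at a ridge point `W = νZ` one has
`d/dt KE = 0` and `d²/dt² KE = Ẇ − νŻ < 0`, i.e. for the face `h₀ = E − KE`: `h₀ = 0`, `ḣ₀ = 0`, `ḧ₀ > 0`, while the work and
enstrophy faces are inactive):

* `stay_of_secondOrder_tangency` — for a continuous semiflow, finitely many continuous faces `h i` with continuous first and
  second flow-derivatives `d i`, `dd i`, and a forward-invariant `M ∋ x`: if every face is either inactive at `x` (`h i x > 0`), or
  active and entering to first order (`h i x = 0 < d i x`), or active, first-order tangent and entering to second order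
  (`h i x = 0 = d i x`, `dd i x > 0`), then `φ t x ∈ faceSet h ∩ M` for all `t ∈ (0, δ)`, some `δ > 0`.

Combined with p108924 this is the second-order internal-tangency criterion: such an `x` which is moreover a limit of block points
with an active face of negative derivative makes `B⁻` non-closed, so the block is not a Ważewski set in Conley's sense.
References: C. Conley, CBMS 38 (1978), Ch. II §2 (internal tangencies); P. Hartman, *ODE*, Ch. X §3 (egress/ingress points).
-/

-- `Summit.<Summit>.<Problem>` is the tree's mandated summit-side namespace (CONVENTIONS §2); deliberate duplicate.
set_option linter.dupNamespace false

namespace Summit.AnomalousDissipation.AnomalousDissipation.Theorems.UniformGalerkinTrap.Sketch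

open Set Filter Topology
open Literature.Dynamics.ConleyIndex

variable {X : Type*} [TopologicalSpace X] {φ : ℝ → X → X}

/-- An observable along an orbit which vanishes at time `0` and has positive derivative on `(0, ε]` is positive on `(0, ε]`
(strict monotonicity on `[0, ε]` from the mean value theorem; continuity of the orbit from the right at `0`). [folklore] -/
theorem secondOrderStay_aux_pos_of_deriv_pos_on (hφ : IsSemiflow φ) {g e : X → ℝ} (hg : Continuous g) {x : X}
    (hder : ∀ t : ℝ, 0 < t → HasDerivAt (fun s => g (φ s x)) (e (φ t x)) t) (h0 : g x = 0) {ε : ℝ} (hε : 0 < ε)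
    (hpos : ∀ s ∈ Ioc 0 ε, 0 < e (φ s x)) : ∀ s ∈ Ioc 0 ε, 0 < g (φ s x) := by
  have hmono : StrictMonoOn (fun s => g (φ s x)) (Icc 0 ε) := by
    refine strictMonoOn_of_deriv_pos (convex_Icc _ _) ?_ fun s hs => ?_
    · exact hg.comp_continuousOn ((hφ.continuousOn_orbit x).mono fun s hs => hs.1)
    · rw [interior_Icc] at hs
      rw [(hder s hs.1).deriv]
      exact hpos s ⟨hs.1, hs.2.le⟩
  intro s hs
  have hlt := hmono (left_mem_Icc.2 hε.le) ⟨hs.1.le, hs.2⟩ hs.1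
  simpa [hφ.map_zero, h0] using hlt

/-- A continuous observable which is positive at `x` is positive along the orbit of `x` on some `(0, ε]`
(right-continuity of the orbit at `0`). [folklore] -/
theorem secondOrderStay_aux_eventually_pos (hφ : IsSemiflow φ) {g : X → ℝ} (hg : Continuous g) {x : X}
    (hpos : 0 < g x) : ∃ ε > 0, ∀ s ∈ Ioc 0 ε, 0 < g (φ s x) := by
  have hc : ContinuousWithinAt (fun s => g (φ s x)) (Ici 0) 0 :=
    hg.continuousAt.comp_continuousWithinAt (hφ.continuousWithinAt_orbit x le_rfl)
  have hpos' : 0 < g (φ 0 x) := by rwa [hφ.map_zero]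
  have hev : ∀ᶠ s in 𝓝[Ici (0 : ℝ)] 0, 0 < g (φ s x) := hc (isOpen_Ioi.mem_nhds hpos')
  rw [nhdsWithin, eventually_inf_principal, Metric.eventually_nhds_iff] at hev
  obtain ⟨ε, hε, hball⟩ := hev
  refine ⟨ε / 2, by positivity, fun s hs => hball ?_ hs.1.le⟩
  rw [Real.dist_eq, sub_zero, abs_of_pos hs.1]
  linarith [hs.2]

/-- **One face, pointwise data of order ≤ 2 ⇒ the face stays non-negative just after time `0`.**  For a continuous semiflow
`φ`, a continuous face `g` with continuous flow-derivative `e` and continuous second flow-derivative `ee` (derivatives along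
every orbit at every `t > 0`): if `g x > 0`, or `g x = 0 < e x`, or `g x = 0 = e x` and `ee x > 0`, then `g (φ s x) > 0` for all
`s ∈ (0, ε]`, some `ε > 0`. [folklore] -/
theorem secondOrderStay_face (hφ : IsSemiflow φ) {g e ee : X → ℝ} (hg : Continuous g) (he : Continuous e)
    (hee : Continuous ee) {x : X}
    (hder : ∀ t : ℝ, 0 < t → HasDerivAt (fun s => g (φ s x)) (e (φ t x)) t)
    (hder2 : ∀ t : ℝ, 0 < t → HasDerivAt (fun s => e (φ s x)) (ee (φ t x)) t)
    (hx : 0 < g x ∨ (g x = 0 ∧ 0 < e x) ∨ (g x = 0 ∧ e x = 0 ∧ 0 < ee x)) :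
    ∃ ε > 0, ∀ s ∈ Ioc 0 ε, 0 < g (φ s x) := by
  rcases hx with hpos | ⟨h0, hpos⟩ | ⟨h0, h1, hpos⟩
  · exact secondOrderStay_aux_eventually_pos hφ hg hpos
  · obtain ⟨ε, hε, hε'⟩ := secondOrderStay_aux_eventually_pos hφ he hpos
    exact ⟨ε, hε, secondOrderStay_aux_pos_of_deriv_pos_on hφ hg hder h0 hε hε'⟩
  · obtain ⟨ε, hε, hε'⟩ := secondOrderStay_aux_eventually_pos hφ hee hpos
    have hd : ∀ s ∈ Ioc 0 ε, 0 < e (φ s x) := secondOrderStay_aux_pos_of_deriv_pos_on hφ he hder2 h1 hε hε'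
    exact ⟨ε, hε, secondOrderStay_aux_pos_of_deriv_pos_on hφ hg hder h0 hε hd⟩

/-- **Stay lemma for second-order internal tangencies** (registered sub-goal of stmt-AnomalousDissipation-10352, closed
`∀`-form).  Let `φ` be a continuous semiflow, `h i` (`i` in a finite type) continuous faces with continuous first and second
flow-derivatives `d i`, `dd i`, `M` forward invariant, `x ∈ M`.  If at `x` every face is inactive (`h i x > 0`), or active and
entering to first order (`h i x = 0 < d i x`), or active, tangent to first order and entering to second order
(`h i x = 0 = d i x < dd i x`), then the orbit of `x` lies in `faceSet h ∩ M` for all times in some `(0, δ)` — so `x` is NOT an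
immediate exit point; if `x` is a limit of first-order exit points, `Sketch.not_isClosed_immediateExitSet_of_tangency` (p108924)
concludes that the immediate exit set is not closed. [cite: Conley1978, Ch. II §2] -/
theorem stay_of_secondOrder_tangency :
    ∀ {X : Type} [TopologicalSpace X] {ι : Type} [Finite ι] (φ : ℝ → X → X) (h d dd : ι → X → ℝ) (M : Set X) (x : X),
      IsSemiflow φ → (∀ i, Continuous (h i)) → (∀ i, Continuous (d i)) → (∀ i, Continuous (dd i)) →
      (∀ i y t, 0 < t → HasDerivAt (fun s => h i (φ s y)) (d i (φ t y)) t) →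
      (∀ i y t, 0 < t → HasDerivAt (fun s => d i (φ s y)) (dd i (φ t y)) t) →
      (∀ y ∈ M, ∀ t : ℝ, 0 ≤ t → φ t y ∈ M) → x ∈ M →
      (∀ i, 0 < h i x ∨ (h i x = 0 ∧ 0 < d i x) ∨ (h i x = 0 ∧ d i x = 0 ∧ 0 < dd i x)) →
      ∃ δ > 0, ∀ t ∈ Set.Ioo 0 δ, φ t x ∈ faceSet h ∩ M := by
  intro X _ ι _ φ h d dd M x hφ hh hd hdd hder hder2 hM hxM hx
  -- each face stays positive on some `(0, ε i]`
  have hface : ∀ i, ∃ ε > 0, ∀ s ∈ Ioc 0 ε, 0 < h i (φ s x) := fun i =>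
    secondOrderStay_face hφ (hh i) (hd i) (hdd i) (fun t ht => hder i x t ht) (fun t ht => hder2 i x t ht) (hx i)
  choose ε hε hεpos using hface
  cases isEmpty_or_nonempty ι with
  | inl hι =>
      refine ⟨1, one_pos, fun t ht => ⟨fun i => (hι.false i).elim, hM x hxM t ht.1.le⟩⟩
  | inr hι =>
      haveI := Fintype.ofFinite ι
      obtain ⟨i₀, -, hi₀⟩ := Finset.exists_min_image Finset.univ ε Finset.univ_nonempty
      refine ⟨ε i₀, hε i₀, fun t ht => ⟨fun i => ?_, hM x hxM t ht.1.le⟩⟩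
      exact (hεpos i t ⟨ht.1, ht.2.le.trans (hi₀ i (Finset.mem_univ i))⟩).le

end Summit.AnomalousDissipation.AnomalousDissipation.Theorems.UniformGalerkinTrap.Sketch
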